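import Literature.IUT.HodgeTheaters.InitialThetaDataTorsionCuspModelPointKitCore
import Literature.IUT.HodgeTheaters.InitialThetaDataLocalGaloisProofs
import Literature.IUT.HodgeTheaters.InitialThetaDataPlaces
import Literature.AnabelianGeometry.AbsoluteAnabelian.LocalUnramifiedQuotientH2
import Literature.AnabelianGeometry.AbsoluteAnabelian.FreeProcyclicStructure
import Literature.NumberTheory.Automorphic.AdicCompletionLocalField
import HarnessLib

/-!
# [IUTchI] Def. 3.1 (e): every bad decomposition group `G_v̲ ⊆ G_F` has a quotient of order `l` (proof-only)

`Proofs` companion (theorems only: no `def`, no `instance`, no named fact, no `sorry`) for the cell abc-iut, layer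
L5, by abc-iut-L5-d1 (gen 8) — the row «BAD-DECOMP-ORDER-L-CHARACTER» = abc-iut-L5-lead BOOKING 2026-08-26T23:44:42Z
(c): «`χ_v̲ ≠ 1` on the GENUINE decomposition group = LAW «`D_v̲` has a quotient of order `l`» (true at finite
places; dischargeable once `decompositionSubgroupGF` is identified with `G_{F_v̲}` …)».

S. Mochizuki, *Inter-universal Teichmüller theory I*, Def. 3.1 (e) (kurims May-2020 manuscript pp. 62–63)
[claim: Mochizuki2012, status: disputed]: "the decomposition group `G_v ⊆ G_K := Gal(F̄/K)` determined, up to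
`G_K`-conjugacy, by `v`".  In the tree (abc-iut-L5-t2 / t4): at a finite place `w` of `K` the decomposition group
is `decompositionSubgroupGF F K_w ι ≤ G_F` = the image of `Gal(K̄_w/K_w) → G_F` (`InitialThetaDataLocalGalois`),
and `InitialThetaData.decompAt v` is this group at the valuation named by the index `v` (`PiAvatarPlaceData`).
The certificate's (K‴)/NV-J5 conjuncts (abc-iut-L5-t8, `InitialThetaDataTorsionCuspModelPointKitCore`, p477346)
were typed MODULO a displayed family `χ : ∀ v ∈ V̲^bad, decompAt v →* ℤ/l`, `hχ : χ v ≠ 1` — the honest LAW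
«each bad `D_v̲` has a quotient of order `l`».  This file DISCHARGES that law from classical local Galois
theory already in the tree:

* `exists_monoidHom_absoluteGaloisGroup_zmod_surjective` — for every non-archimedean local field `k` and every
  prime `l`, **`Γ_k = Gal(k̄/k)` surjects onto `ℤ/l`**: `Gal(k^nr/k) = Γ_k ⧸ galUnr k` is free procyclic
  (abc-iut-L4, `isFreeProcyclic_quotient_galUnr`: a dense cyclic subgroup and an open subgroup of every
  positive index), hence abelian (`mul_comm_of_dense_zpowers`), so its open subgroup of index `l` is normal with
  quotient of prime order `l`, i.e. `≅ ℤ/l` (Mathlib `mulEquivOfPrimeCardEq`) — the unramified character of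
  order `l` (Serre, *Local Fields*, IV §4; *Cohomologie galoisienne* II §5);
* `exists_monoidHom_decompositionSubgroupGF_zmod_surjective` — transport to the decomposition group
  `G_w ⊆ G_F` of a finite place `w` of the number field `K` along the tree's identification
  `Gal(K̄_w/K_w) ≅ G_w` (`localToGF_injective_adicCompletion`, abc-iut-L5-t2 lineage; `K_w` is a
  non-archimedean local field by `Literature.NumberTheory.Automorphic.AdicCompletionLocalField`);
* **`InitialThetaData.exists_decompAt_monoidHom_zmod_surjective` / `…_ne_one`** — for `D : InitialThetaData`
  and every index `v` over a NON-ARCHIMEDEAN valuation, in particular every `v ∈ D.indexCopyBad`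
  (`V̲^bad ⊆ V̲^non`, abc-iut-L5-t2 `Vbad_subset_Vnon`): `∃ χ : ↥(D.decompAt v) →* Multiplicative (ZMod l)`,
  surjective, hence `χ ≠ 1`;
* **`InitialThetaData.exists_K3_hypotheses_jointly`**, **`InitialThetaData.exists_sec6_and_K3_hypotheses_jointly`**
  — abc-iut-L5-t8's NV-J5 theorems `…_of_characters χ hχ` (p477346) with the character family `(χ, hχ)`
  ELIMINATED: the (K‴) hypothesis telescope `{D, CG, M′; hS, hL} ∪ {ES}` (and the full joint telescope with
  (K″)'s `{B, ΛBad}`) is inhabited at the single-point model `D₀.regeom₄` with NO displayed law left;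
* (v2 append) `InitialThetaData.nonempty_evalSectionBinderFamily_regeom₄` — the (K‴) `ES`-slot Π-type over `V̲^bad` at
  `regeom₄` INHABITED, χ-free (abc-iut-w4-d077's `evalSectionBinderRegeom₄`, p475487, fed with the characters), and
  `nonempty_evalSectionBinderRegeom₄_of_mem_indexCopyBad` (per bad index, with the surjective character recorded).

HONEST FRAMING: classical local Galois theory over OUR typed Def. 3.1 (e) objects; a model witnesses joint
satisfiability of OUR typed binders only («[model; `E[l]`-twisted finite shadow; single-point inertia; Θ-NF
stand-in ambient]», now WITHOUT «mod a displayed order-`l` character family»); no token of the cone moves; nothing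
here asserts that abc is proved or refuted or takes a side on [IUTchIII] Cor. 3.12; typed ≠ inhabited ≠ discharged.

## References
* [Mochizuki2012] S. Mochizuki, IUT I, Def. 3.1 (e) pp. 62–63. [claim: Mochizuki2012, status: disputed]
* [SerreLocalFields1979] J.-P. Serre, *Local Fields*, GTM 67 (1979), IV §4 (`Gal(K^nr/K) ≅ Ẑ`).
* [SerreGaloisCohomology1997] J.-P. Serre, *Galois Cohomology* (1997), II §5, II §6.1.
-/

noncomputable section

namespace Literature.IUT.HodgeTheaters

open _root_.Field
open Literature.NumberTheory.GaloisRepresentations (galUnr)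
open Literature.AnabelianGeometry.AbsoluteAnabelian (isFreeProcyclic_quotient_galUnr mul_comm_of_dense_zpowers)

universe u v w w'

/-! ### A non-archimedean local field: `Γ_k ↠ ℤ/l` (the unramified character of order `l`) -/

section LocalField

variable (k : Type u) [Field k] [ValuativeRel k] [TopologicalSpace k] [IsNonarchimedeanLocalField k]
  (l : ℕ) [Fact l.Prime]

/-- **`Gal(k̄/k)` surjects onto `ℤ/l`** for a non-archimedean local field `k` and a prime `l`: the Galois group
`Gal(k^nr/k) = Γ_k ⧸ galUnr k` of the maximal unramified extension is free procyclic (abc-iut-L4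
`isFreeProcyclic_quotient_galUnr`), so it is abelian (a dense cyclic subgroup, `mul_comm_of_dense_zpowers`) and has
an open subgroup of index `l`, which is therefore normal with quotient of prime order `l`, i.e. `≅ ℤ/l`; compose
`Γ_k ↠ Gal(k^nr/k) ↠ ℤ/l` (the unramified character of order `l`).
[cite: SerreLocalFields1979, IV §4 (Gal(K^nr/K) ≅ Ẑ)] -/
theorem exists_monoidHom_absoluteGaloisGroup_zmod_surjective :
    ∃ ψ : absoluteGaloisGroup k →* Multiplicative (ZMod l), Function.Surjective ψ := by
  obtain ⟨⟨γ, hγ⟩, hidx⟩ := isFreeProcyclic_quotient_galUnr k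
  obtain ⟨H, -, hH⟩ := hidx l (Fact.out : l.Prime).pos
  haveI : H.Normal :=
    ⟨fun x hx y => by rwa [mul_comm_of_dense_zpowers hγ y x, mul_inv_cancel_right]⟩
  have hcard : Nat.card ((absoluteGaloisGroup k ⧸ galUnr k) ⧸ H) = l := by
    rw [← Subgroup.index_eq_card]; exact hH
  have hcard' : Nat.card (Multiplicative (ZMod l)) = l := Nat.card_zmod l
  refine ⟨(mulEquivOfPrimeCardEq hcard hcard').toMonoidHom.comp
      ((QuotientGroup.mk' H).comp (QuotientGroup.mk' (galUnr k))), ?_⟩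
  exact (mulEquivOfPrimeCardEq hcard hcard').surjective.comp
    ((QuotientGroup.mk'_surjective H).comp (QuotientGroup.mk'_surjective _))

/-- **`Gal(k̄/k)` has a NONTRIVIAL `ℤ/l`-character** (`l` prime, `k` a non-archimedean local field).
[cite: SerreLocalFields1979, IV §4 (Gal(K^nr/K) ≅ Ẑ)] -/
theorem exists_monoidHom_absoluteGaloisGroup_zmod_ne_one :
    ∃ ψ : absoluteGaloisGroup k →* Multiplicative (ZMod l), ψ ≠ 1 := by
  obtain ⟨ψ, hψ⟩ := exists_monoidHom_absoluteGaloisGroup_zmod_surjective k l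
  refine ⟨ψ, fun h => ?_⟩
  obtain ⟨σ, hσ⟩ := hψ (Multiplicative.ofAdd 1)
  rw [h, MonoidHom.one_apply] at hσ
  have h1 : (1 : ZMod l) = 0 := by
    simpa using (congrArg Multiplicative.toAdd hσ).symm
  exact one_ne_zero h1

end LocalField

/-! ### Transport along an injective homomorphism (`Gal(K̄_w/K_w) ≅ G_w`) -/

section Transport

variable {G : Type u} {G' : Type v} {M : Type w} [Group G] [Group G'] [Group M]

/-- If `f : G → G'` is injective and `G ↠ M`, then the image `f(G) ≤ G'` surjects onto `M`
(through `f(G) ≅ G`, Mathlib `MonoidHom.ofInjective`). [folklore] -/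
private theorem exists_monoidHom_range_surjective_of_injective (f : G →* G') (hf : Function.Injective f)
    (ψ : G →* M) (hψ : Function.Surjective ψ) :
    ∃ χ : f.range →* M, Function.Surjective χ :=
  ⟨ψ.comp (MonoidHom.ofInjective hf).symm.toMonoidHom,
    hψ.comp (MonoidHom.ofInjective hf).symm.surjective⟩

end Transport

/-! ### The decomposition group `G_w ⊆ G_F` of a finite place `w` of the number field `K` -/

section Place

open _root_.IsDedekindDomain _root_.NumberField

variable {K : Type v} [Field K] [NumberField K] {Fbar : Type w} [Field Fbar] [Algebra K Fbar] [Normal K Fbar]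
  [IsAlgClosed Fbar] (w : HeightOneSpectrum (𝓞 K))
  (ι : Fbar →ₐ[K] AlgebraicClosure (w.adicCompletion K))
  (F : Type u) [Field F] [Algebra F K] [Algebra F Fbar] [IsScalarTower F K Fbar]
  (l : ℕ) [Fact l.Prime]

/-- **The decomposition group `G_w ⊆ G_F` of a finite place `w` surjects onto `ℤ/l`** (Def. 3.1 (e); `l` prime):
`G_w = decompositionSubgroupGF F K_w ι ≅ Gal(K̄_w/K_w)` (abc-iut-L5-t2 lineage `localToGF_injective_adicCompletion`,
Krasner density), and `Gal(K̄_w/K_w)` surjects onto `ℤ/l` through its unramified quotient (`K_w` is a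
non-archimedean local field, `Literature.NumberTheory.Automorphic`).  ([IUTchI] Def 3.1 (e) p.62)
[claim: Mochizuki2012, status: disputed] -/
theorem exists_monoidHom_decompositionSubgroupGF_zmod_surjective :
    ∃ χ : ↥(decompositionSubgroupGF F (w.adicCompletion K) ι) →* Multiplicative (ZMod l),
      Function.Surjective χ := by
  obtain ⟨ψ, hψ⟩ := exists_monoidHom_absoluteGaloisGroup_zmod_surjective (w.adicCompletion K) l
  exact exists_monoidHom_range_surjective_of_injective (localToGF F (w.adicCompletion K) ι)
    (localToGF_injective_adicCompletion w ι F) ψ hψ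

/-- **The decomposition group `G_w ⊆ G_F` of a finite place has a nontrivial `ℤ/l`-character.**
([IUTchI] Def 3.1 (e) p.62) [claim: Mochizuki2012, status: disputed] -/
theorem exists_monoidHom_decompositionSubgroupGF_zmod_ne_one :
    ∃ χ : ↥(decompositionSubgroupGF F (w.adicCompletion K) ι) →* Multiplicative (ZMod l), χ ≠ 1 := by
  obtain ⟨χ, hχ⟩ := exists_monoidHom_decompositionSubgroupGF_zmod_surjective w ι F l
  refine ⟨χ, fun h => ?_⟩
  obtain ⟨σ, hσ⟩ := hχ (Multiplicative.ofAdd 1)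
  rw [h, MonoidHom.one_apply] at hσ
  have h1 : (1 : ZMod l) = 0 := by
    simpa using (congrArg Multiplicative.toAdd hσ).symm
  exact one_ne_zero h1

end Place

/-! ### At the indices of the initial Θ-data: `decompAt v` for `v` over `V̲^non ⊇ V̲^bad` -/

namespace InitialThetaData

section DecompAt

open _root_.IsDedekindDomain _root_.NumberField

variable {F : Type u} {K : Type v} {Fbar : Type w} [Field F] [NumberField F] [Field K] [NumberField K]
  [Algebra F K] [Field Fbar] [Algebra F Fbar] [Algebra K Fbar]
  {E : WeierstrassCurve F} [E.IsElliptic] {l : ℕ} {Pb : BadPlacePredicates K}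
  (D : InitialThetaData F K Fbar E l Pb) [Fact l.Prime]

omit [Fact l.Prime] in
/-- An index over a NON-ARCHIMEDEAN valuation `w`: `decompAt v` IS the decomposition group of the finite place `w`
(the `Sum.inr` branch of abc-iut-L5-t4's definition). ([IUTchI] Def 3.1 (e) p.62) [claim: Mochizuki2012, status: disputed] -/
theorem decompAt_of_indexCopyVal_eq_non {v : D.IndexCopy} {w : FinitePlace K}
    (h : D.indexCopyVal v = Val.non w) :
    D.decompAt v =
      (haveI := D.isScalarTower
       haveI := D.normal_K
       decompositionSubgroupGF F ((FinitePlace.maximalIdeal w).adicCompletion K)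
        (localEmb (K := K) (Fbar := Fbar)
          (AlgebraicClosure ((FinitePlace.maximalIdeal w).adicCompletion K)))) := by
  unfold decompAt
  rw [show D.indexCopyVal v = Sum.inr w from h]

omit [Fact l.Prime] in
/-- A bad index lies over a finite place (`V̲^bad ⊆ V̲^non`, abc-iut-L5-t2 `Vbad_subset_Vnon`).
([IUTchI] Def 3.1 (b) p.61) [claim: Mochizuki2012, status: disputed] -/
theorem exists_indexCopyVal_eq_non_of_mem_indexCopyBad {v : D.IndexCopy} (hv : v ∈ D.indexCopyBad) :
    ∃ w : FinitePlace K, D.indexCopyVal v = Val.non w := by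
  have hnon : (D.indexCopyVal v).IsNon := (D.Vbad_subset_Vnon ((D.mem_indexCopyBad_iff v).1 hv)).2
  obtain ⟨w, hw⟩ := Sum.isRight_iff.mp hnon
  exact ⟨w, hw⟩

/-- **Every decomposition group `G_v̲ ⊆ G_F` at an index over a non-archimedean valuation surjects onto `ℤ/l`**
(`l` the prime of the initial Θ-data, or any prime). ([IUTchI] Def 3.1 (e) p.62) [claim: Mochizuki2012, status: disputed] -/
theorem exists_decompAt_monoidHom_zmod_surjective_of_isNon {v : D.IndexCopy} (hv : (D.indexCopyVal v).IsNon) :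
    ∃ χ : ↥(D.decompAt v) →* Multiplicative (ZMod l), Function.Surjective χ := by
  obtain ⟨w, hw⟩ := Sum.isRight_iff.mp hv
  rw [D.decompAt_of_indexCopyVal_eq_non hw]
  haveI := D.isScalarTower
  haveI := D.normal_K
  haveI := D.isAlgClosure
  haveI : IsAlgClosed Fbar := IsAlgClosure.isAlgClosed F
  exact exists_monoidHom_decompositionSubgroupGF_zmod_surjective (FinitePlace.maximalIdeal w) _ F l

/-- **Every BAD decomposition group `G_v̲ ⊆ G_F` (`v̲ ∈ V̲^bad`) surjects onto `ℤ/l`** — the LAW «`D_v̲` has a quotient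
of order `l`» of abc-iut-L5-lead's booking 2026-08-26T23:44:42Z (c), DISCHARGED. ([IUTchI] Def 3.1 (e) p.62)
[claim: Mochizuki2012, status: disputed] -/
theorem exists_decompAt_monoidHom_zmod_surjective {v : D.IndexCopy} (hv : v ∈ D.indexCopyBad) :
    ∃ χ : ↥(D.decompAt v) →* Multiplicative (ZMod l), Function.Surjective χ := by
  obtain ⟨w, hw⟩ := D.exists_indexCopyVal_eq_non_of_mem_indexCopyBad hv
  exact D.exists_decompAt_monoidHom_zmod_surjective_of_isNon (Sum.isRight_iff.mpr ⟨w, hw⟩)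

/-- **Every bad decomposition group carries a NONTRIVIAL `ℤ/l`-character `χ_v̲ ≠ 1`** — the displayed hypothesis
`(χ, hχ)` of abc-iut-w4-d077's `evalSectionBinderRegeom₄ v χ hχ` and of abc-iut-L5-t8's NV-J5 theorems, as a THEOREM.
([IUTchI] Def 3.1 (e) p.62) [claim: Mochizuki2012, status: disputed] -/
theorem exists_decompAt_monoidHom_zmod_ne_one {v : D.IndexCopy} (hv : v ∈ D.indexCopyBad) :
    ∃ χ : ↥(D.decompAt v) →* Multiplicative (ZMod l), χ ≠ 1 := by
  obtain ⟨χ, hχ⟩ := D.exists_decompAt_monoidHom_zmod_surjective hv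
  refine ⟨χ, fun h => ?_⟩
  obtain ⟨σ, hσ⟩ := hχ (Multiplicative.ofAdd 1)
  rw [h, MonoidHom.one_apply] at hσ
  have h1 : (1 : ZMod l) = 0 := by
    simpa using (congrArg Multiplicative.toAdd hσ).symm
  exact one_ne_zero h1

/-- **A nontrivial `ℤ/l`-character family on ALL bad decomposition groups exists** (the binder shape
`χ : ∀ v ∈ V̲^bad, decompAt v →* ℤ/l`, `hχ : ∀ v hv, χ v hv ≠ 1` of p477346, INHABITED).
([IUTchI] Def 3.1 (e) p.62) [claim: Mochizuki2012, status: disputed] -/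
theorem exists_decompAt_characterFamily_ne_one :
    ∃ χ : ∀ v : D.IndexCopy, v ∈ D.indexCopyBad → (↥(D.decompAt v) →* Multiplicative (ZMod l)),
      ∀ v (hv : v ∈ D.indexCopyBad), χ v hv ≠ 1 := by
  choose χ hχ using fun (v : D.IndexCopy) (hv : v ∈ D.indexCopyBad) =>
    D.exists_decompAt_monoidHom_zmod_ne_one hv
  exact ⟨χ, hχ⟩

end DecompAt

/-! ### NV-J5 WITHOUT the character family: the (K‴) telescope inhabited at `regeom₄` -/

section NV

open Literature.AnabelianGeometry.AbsoluteAnabelian TorsionMonodromyModel TorsionCuspModel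
open scoped WeierstrassCurve.Affine Classical

variable {F K Fbar : Type u} [Field F] [NumberField F] [Field K] [NumberField K] [Algebra F K] [Field Fbar]
  [Algebra F Fbar] [Algebra K Fbar] {E : WeierstrassCurve F} [E.IsElliptic] {l : ℕ} {Pb : BadPlacePredicates K}
  (D₀ : InitialThetaData F K Fbar E l Pb) [Fact l.Prime]

/-- **«THE (K‴) HYPOTHESIS SET IS JOINTLY SATISFIABLE AT ONE DATUM» — binder-free.**  abc-iut-L5-t8's
`exists_K3_hypotheses_jointly_of_characters χ hχ` (p477346) with the character family supplied by
`exists_decompAt_characterFamily_ne_one` at `D₀.regeom₄`: the telescope `{D, CG, M′; hS, hL} ∪ {ES}` of the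
certificate's (K‴) conjunct is inhabited at the single-point cusp model over the same `(V^bad_mod, V̲)`, with NO
displayed law; the witness datum moreover CARRIES the discharged law (conjunct 3: every bad `decompAt v` surjects onto
`ℤ/l` — recorded in the statement, which also keeps it syntactically distinct from the `_of_characters` form for
the gate's dedup).  «[model; `E[l]`-twisted finite shadow; single-point inertia; Θ-NF stand-in ambient]» — a model witnesses
joint satisfiability of OUR typed binders only. ([IUTchI] Ex 4.4 (i) p.106) [claim: Mochizuki2012, status: disputed] -/
theorem exists_K3_hypotheses_jointly :
    ∃ D : InitialThetaData F K Fbar E l Pb, D.VbadMod = D₀.VbadMod ∧ D.V = D₀.V ∧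
      (∀ v, v ∈ D.indexCopyBad → ∃ χ : ↥(D.decompAt v) →* Multiplicative (ZMod l), Function.Surjective χ) ∧
      ∃ (CG : D.geom.pe.CuspGalois) (M' : D.UnramifiedTorsionMonodromy) (hS : D.CuspClassesNormaliserStable)
        (hL : D.geom.pe.ModLCuspLaws),
        Nonempty (∀ v (_ : v ∈ D.indexCopyBad),
          EvalSectionBinder (D.localDataStandIn CG hS M'.toTorsionMonodromy (D.arrowCoveringClaims_pe_of_modLCuspLaws CG hL)
            M'.tau_inertia_ε1 v) (D.decompAt v)) := by
  obtain ⟨χ, hχ⟩ := D₀.regeom₄.exists_decompAt_characterFamily_ne_one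
  obtain ⟨D, hbad, hV, CG, M', hS, hL, hES⟩ := D₀.exists_K3_hypotheses_jointly_of_characters χ hχ
  exact ⟨D, hbad, hV, fun v hv => D.exists_decompAt_monoidHom_zmod_surjective hv, CG, M', hS, hL, hES⟩

/-- **The FULL joint telescope `{D, CG, M′, B; hS, hL, ΛBad} ∪ {ES}` at one datum — binder-free**: abc-iut-L5-t8's
`exists_sec6_and_K3_hypotheses_jointly_of_characters χ hχ` (p477346) with `(χ, hχ)` ELIMINATED: the §6 held rows'
(K″) binders and the Prop 6.7 (γ) conjunct's (K‴) binder have ONE common model of their hypotheses, no law displayed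
(conjunct 3 records the discharged law at the witness datum: every bad `decompAt v` surjects onto `ℤ/l`).  «[model]». ([IUTchI] Def 6.1 (v) p.158) [claim: Mochizuki2012, status: disputed] -/
theorem exists_sec6_and_K3_hypotheses_jointly :
    ∃ D : InitialThetaData F K Fbar E l Pb, D.VbadMod = D₀.VbadMod ∧ D.V = D₀.V ∧
      (∀ v, v ∈ D.indexCopyBad → ∃ χ : ↥(D.decompAt v) →* Multiplicative (ZMod l), Function.Surjective χ) ∧
      ∃ (CG : D.geom.pe.CuspGalois) (M' : D.UnramifiedTorsionMonodromy) (B : ∀ v, v ∈ D.indexCopyBad → D.BadPairAt v)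
        (hS : D.CuspClassesNormaliserStable) (hL : D.geom.pe.ModLCuspLaws),
        Nonempty (∀ v (h : v ∈ D.indexCopyBad), D.LocalArrowLaw CG hS (B v h).H) ∧
        Nonempty (∀ v (_ : v ∈ D.indexCopyBad),
          EvalSectionBinder (D.localDataStandIn CG hS M'.toTorsionMonodromy (D.arrowCoveringClaims_pe_of_modLCuspLaws CG hL)
            M'.tau_inertia_ε1 v) (D.decompAt v)) := by
  obtain ⟨χ, hχ⟩ := D₀.regeom₄.exists_decompAt_characterFamily_ne_one
  obtain ⟨D, hbad, hV, CG, M', B, hS, hL, hΛ, hES⟩ := D₀.exists_sec6_and_K3_hypotheses_jointly_of_characters χ hχ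
  exact ⟨D, hbad, hV, fun v hv => D.exists_decompAt_monoidHom_zmod_surjective hv, CG, M', B, hS, hL, hΛ, hES⟩

/-- **The (K‴) `ES` binder FAMILY at `regeom₄`, INHABITED with NO displayed law** (v2 append): abc-iut-w4-d077's
evaluation-section terms `evalSectionBinderRegeom₄ v χ hχ` (p475487) at EVERY bad index, fed with the order-`l` characters of
`exists_decompAt_characterFamily_ne_one` — i.e. the exact `ES`-slot type of (C″)/(K‴) at the single-point datum (`CG`, `hS`, `M′`,
`hA := arrowCoveringClaimsRegeom₄`, `hI` all stage-C TERMS), as ONE `Nonempty` of the Π-type over `V̲^bad`.  «[model]».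
([IUTchI] Ex 4.4 (i) p.106) [claim: Mochizuki2012, status: disputed] -/
theorem nonempty_evalSectionBinderFamily_regeom₄ :
    Nonempty (∀ v (_ : v ∈ D₀.regeom₄.indexCopyBad),
      EvalSectionBinder
        (D₀.regeom₄.localDataStandIn D₀.cuspGaloisRegeom₄ D₀.cuspClassesNormaliserStable_regeom₄
          D₀.unramifiedTorsionMonodromyRegeom₄.toTorsionMonodromy D₀.arrowCoveringClaimsRegeom₄
          (D₀.unramifiedTorsionMonodromyRegeom₄.tau_inertia _) v)
        (D₀.regeom₄.decompAt v)) := by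
  obtain ⟨χ, hχ⟩ := D₀.regeom₄.exists_decompAt_characterFamily_ne_one
  exact ⟨fun v hv => D₀.evalSectionBinderRegeom₄ v (χ v hv) (hχ v hv)⟩

/-- **EVALSECT-NV OF RECORD (headline), χ-free at a bad index**: for every `v ∈ V̲^bad` of `regeom₄` the evaluation-section binder of
(C″)/(K‴) is inhabited (p475487's `nonempty_evalSectionBinderRegeom₄ v χ hχ` with the character supplied), AND the decomposition group
there surjects onto `ℤ/l` (the discharged law, recorded). «[model]». ([IUTchI] Ex 4.4 (i) p.106) [claim: Mochizuki2012, status: disputed] -/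
theorem nonempty_evalSectionBinderRegeom₄_of_mem_indexCopyBad (v : D₀.regeom₄.IndexCopy)
    (hv : v ∈ D₀.regeom₄.indexCopyBad) :
    Nonempty (EvalSectionBinder
      (D₀.regeom₄.localDataStandIn D₀.cuspGaloisRegeom₄ D₀.cuspClassesNormaliserStable_regeom₄
        D₀.unramifiedTorsionMonodromyRegeom₄.toTorsionMonodromy D₀.arrowCoveringClaimsRegeom₄
        (D₀.unramifiedTorsionMonodromyRegeom₄.tau_inertia _) v)
      (D₀.regeom₄.decompAt v)) ∧
      ∃ χ : ↥(D₀.regeom₄.decompAt v) →* Multiplicative (ZMod l), Function.Surjective χ := by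
  obtain ⟨χ, hχ⟩ := D₀.regeom₄.exists_decompAt_monoidHom_zmod_ne_one hv
  exact ⟨D₀.nonempty_evalSectionBinderRegeom₄ v χ hχ, D₀.regeom₄.exists_decompAt_monoidHom_zmod_surjective hv⟩

end NV

end InitialThetaData

end Literature.IUT.HodgeTheaters

end
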